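import Mathlib.Data.Finset.Card
import Mathlib.Algebra.BigOperators.Group.Finset.Basic
import Mathlib.Algebra.Order.BigOperators.Group.Finset

/-!
# PercRepro — THE SPEC of the 4-circuit-cap search (p1, gen 22; the s₄ seat)

`proofs/P1-S4-PERPOINT.md` §9.4 / `proofs/P1-S4-CAPBRIDGE.md` §1. An ABSTRACT LINE CONFIGURATION is a finite set of
points (the parallel classes of `M ／ {e}`) with weights `1` or `2` (class sizes) and a finite set of lines (finite sets
of points). For an ORDERING of lines (a list, the head added LAST, as in `S1CoreCostModel.costSum`) the search's
rank bound is `lineRank l = Σ_j min(new_j, 2 − min(old_j, 2))` with `old_j` / `new_j` the numbers of points of the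
`j`-th line on / off the union of the earlier ones. `FourCapSpec cap ν Q` says: on EVERY configuration whose lines
have `≥ 3` points of total weight `≤ 5`, meet pairwise in `≤ 1` point, and satisfy the COST CLAUSE (for every
sub-list `l`, `wsum (unionL l) ≤ ν + lineRank l`) and the PLANE CLAUSES (`lineRank l ≤ 3 ⟹ |unionL l| ≤ 9`,
`lineRank l ≤ 4 ⟹ |unionL l| ≤ 20`), the caps `cap (#points) (#fat points)` sum to at most `Q`. The search
(lean-drafts/p1/s4b/search/fourcap.py; the engine's twin fourcap.c) computes the least such `Q` for each `ν`:
`Q*(1..7) = 1, 4, 5, 8, 11, 16, 19` for the paper table `capPaper`. The BRIDGE (`S1CoreCapBridge`) proves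
`#4circ(e) ≤ Q` on the e-free core of nullity `ν` from `FourCapSpec capPaper ν Q`. Nothing here is about matroids.
Axioms: standard.
-/

namespace PercRepro

namespace S1

namespace FourCap

variable {β : Type} [DecidableEq β]

/-- The union of a list of lines (the head is added last). -/
def unionL : List (Finset β) → Finset β
  | [] => ∅
  | L :: l => L ∪ unionL l


/-- Membership in the union of a list of lines. -/
theorem mem_unionL_iff {v : β} : ∀ {l : List (Finset β)}, v ∈ unionL l ↔ ∃ L ∈ l, v ∈ L
  | [] => by simp [unionL]
  | L :: l => by
    simp only [unionL, Finset.mem_union, List.mem_cons, exists_eq_or_imp]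
    rw [mem_unionL_iff]

/-- The search's rank bound for one ordering of lines: each line adds `min(new, 2 − min(old, 2))`, where `old` /
`new` count its points on / off the union of the earlier (later-in-the-list) lines. -/
def lineRank : List (Finset β) → ℕ
  | [] => 0
  | L :: l => lineRank l + min (L \ unionL l).card (2 - min (L ∩ unionL l).card 2)

/-- The weight of a set of points. -/
def wsum (w : β → ℕ) (S : Finset β) : ℕ := ∑ v ∈ S, w v

/-- The fat points of a line (weight 2). -/
def fat (w : β → ℕ) (L : Finset β) : ℕ := (L.filter (fun v => w v = 2)).card

/-- **The paper cap table** `cap k f` for a line of `k` points of which `f` are fat (`k ≥ 3`, `k + f ≤ 5`):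
simple lines `1 / 4 / 5`, one fat point `2 / 5`, two fat points `3`. Every entry is a Lean fact about the e-free
core (`S1CoreCapFat`, `S1CoreCapFive`, `S1CoreCapThree`). -/
def capPaper (k f : ℕ) : ℕ :=
  match k, f with
  | 3, 0 => 1
  | 4, 0 => 4
  | 5, 0 => 5
  | 3, 1 => 2
  | 4, 1 => 5
  | 3, 2 => 3
  | _, _ => 0

/-- **THE SPEC** of the 4-circuit-cap search at nullity `ν` with answer `Q`, for a cap table `cap`. -/
def FourCapSpec (cap : ℕ → ℕ → ℕ) (ν Q : ℕ) : Prop :=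
  ∀ (β : Type) [DecidableEq β] (w : β → ℕ) (ls : Finset (Finset β)),
    (∀ L ∈ ls, ∀ v ∈ L, w v = 1 ∨ w v = 2) →
    (∀ L ∈ ls, 3 ≤ L.card ∧ wsum w L ≤ 5) →
    (∀ L ∈ ls, ∀ L' ∈ ls, L ≠ L' → (L ∩ L').card ≤ 1) →
    (∀ l : List (Finset β), l.Nodup → (∀ L ∈ l, L ∈ ls) → wsum w (unionL l) ≤ ν + lineRank l) →
    (∀ l : List (Finset β), l.Nodup → (∀ L ∈ l, L ∈ ls) → lineRank l ≤ 3 → (unionL l).card ≤ 9) →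
    (∀ l : List (Finset β), l.Nodup → (∀ L ∈ l, L ∈ ls) → lineRank l ≤ 4 → (unionL l).card ≤ 20) →
    ∑ L ∈ ls, cap L.card (fat w L) ≤ Q

/-- A pointwise smaller cap table inherits the spec. -/
theorem FourCapSpec.mono {cap cap' : ℕ → ℕ → ℕ} (hle : ∀ k f, cap k f ≤ cap' k f) {ν Q : ℕ}
    (h : FourCapSpec cap' ν Q) : FourCapSpec cap ν Q := by
  intro β _ w ls h1 h2 h3 h4 h5 h6
  exact (Finset.sum_le_sum (fun L _ => hle L.card (fat w L))).trans (h β w ls h1 h2 h3 h4 h5 h6)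

/-- A larger answer inherits the spec. -/
theorem FourCapSpec.mono_right {cap : ℕ → ℕ → ℕ} {ν Q Q' : ℕ} (hQ : Q ≤ Q') (h : FourCapSpec cap ν Q) :
    FourCapSpec cap ν Q' := by
  intro β _ w ls h1 h2 h3 h4 h5 h6
  exact (h β w ls h1 h2 h3 h4 h5 h6).trans hQ

/-- A smaller nullity inherits the spec (the cost clause relaxes). -/
theorem FourCapSpec.mono_nullity {cap : ℕ → ℕ → ℕ} {ν ν' Q : ℕ} (hν : ν ≤ ν') (h : FourCapSpec cap ν' Q) :
    FourCapSpec cap ν Q := by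
  intro β _ w ls h1 h2 h3 h4 h5 h6
  refine h β w ls h1 h2 h3 (fun l hl hls => (h4 l hl hls).trans (by omega)) h5 h6

/-- The values of the paper table at the six admissible shapes. -/
theorem capPaper_values : capPaper 3 0 = 1 ∧ capPaper 4 0 = 4 ∧ capPaper 5 0 = 5 ∧ capPaper 3 1 = 2 ∧
    capPaper 4 1 = 5 ∧ capPaper 3 2 = 3 := by
  decide

/-- `wsum` over a union of disjoint sets. -/
theorem wsum_union_of_disjoint (w : β → ℕ) {S T : Finset β} (h : Disjoint S T) :
    wsum w (S ∪ T) = wsum w S + wsum w T := by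
  unfold wsum
  exact Finset.sum_union h

omit [DecidableEq β] in
/-- The weight of a line with `k` points of weights `1` or `2` is `k + fat`. -/
theorem wsum_eq_card_add_fat (w : β → ℕ) (L : Finset β) (hw : ∀ v ∈ L, w v = 1 ∨ w v = 2) :
    wsum w L = L.card + fat w L := by
  unfold wsum fat
  rw [Finset.card_eq_sum_ones, Finset.card_eq_sum_ones, Finset.sum_filter, ← Finset.sum_add_distrib]
  refine Finset.sum_congr rfl (fun v hv => ?_)
  rcases hw v hv with h | h <;> simp [h]

/-- **The typed cap table** (every entry from `S1CoreCapLemmas` / `S1CoreCapFat` alone, before `S1CoreCapFive` and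
`S1CoreCapThree`): simple lines `1 / 4 / 6`, one fat point `2 / 6`, two fat points `4`. Pointwise `≥ capPaper`. -/
def capTyped (k f : ℕ) : ℕ :=
  match k, f with
  | 3, 0 => 1
  | 4, 0 => 4
  | 5, 0 => 6
  | 3, 1 => 2
  | 4, 1 => 6
  | 3, 2 => 4
  | _, _ => 0

/-- `capPaper ≤ capTyped` pointwise. -/
theorem capPaper_le_capTyped (k f : ℕ) : capPaper k f ≤ capTyped k f := by
  unfold capPaper capTyped
  split <;> omega

/-- An instance of the spec for the typed table is one for the paper table (the searches' typed values
`1, 4, 6, 8, 12, 16, 20` may replace the paper values `1, 4, 5, 8, 11, 16, 19`). -/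
theorem FourCapSpec.of_typed {ν Q : ℕ} (h : FourCapSpec capTyped ν Q) : FourCapSpec capPaper ν Q :=
  FourCapSpec.mono capPaper_le_capTyped h

omit [DecidableEq β] in
/-- The weight of a line is at least its number of points (weights `1` or `2`). -/
theorem card_le_wsum (w : β → ℕ) (L : Finset β) (hw : ∀ v ∈ L, w v = 1 ∨ w v = 2) : L.card ≤ wsum w L := by
  unfold wsum
  rw [Finset.card_eq_sum_ones]
  exact Finset.sum_le_sum (fun v hv => by rcases hw v hv with h | h <;> omega)

/-- **Sanity instance, proved**: at nullity `0` the spec holds with `Q = 0` (no line fits: a single line has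
`lineRank = 2 < 3 ≤ wsum`). -/
theorem fourCapSpec_zero : FourCapSpec capPaper 0 0 := by
  intro β _ w ls h1 h2 _ h4 _ _
  have hempty : ls = ∅ := by
    by_contra hne
    obtain ⟨L, hL⟩ := Finset.nonempty_iff_ne_empty.2 hne
    have h := h4 [L] (List.nodup_singleton L) (by simpa using hL)
    simp only [unionL, lineRank, Finset.union_empty, Finset.sdiff_empty, Finset.inter_empty, Finset.card_empty,
      Nat.zero_add] at h
    have h3L := (h2 L hL).1
    have hw := card_le_wsum w L (h1 L hL)
    omega
  subst hempty
  simp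

/-- **Sanity instance, proved**: at nullity `1` the spec holds with `Q = 1` — a configuration of cost `≤ 1` is a single
simple 3-point line (a second line would need `wsum ≥ 6 − |L ∩ L'|` against `lineRank = 4 − |L ∩ L'|`). -/
theorem fourCapSpec_one : FourCapSpec capPaper 1 1 := by
  intro β _ w ls h1 h2 h3 h4 _ _
  rcases Finset.eq_empty_or_nonempty ls with hempty | ⟨L, hL⟩
  · subst hempty; simp
  -- the line `L` is a simple 3-point line
  have hw := card_le_wsum w L (h1 L hL)
  have h3L := (h2 L hL).1
  have hL1 := h4 [L] (List.nodup_singleton L) (by simpa using hL)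
  simp only [unionL, lineRank, Finset.union_empty, Finset.sdiff_empty, Finset.inter_empty, Finset.card_empty,
    Nat.zero_add] at hL1
  have hcard : L.card = 3 := by omega
  have hws : wsum w L = 3 := by omega
  have hfat : fat w L = 0 := by
    have := wsum_eq_card_add_fat w L (h1 L hL); omega
  -- `ls = {L}`
  have hsingle : ls = {L} := by
    refine Finset.eq_singleton_iff_unique_mem.2 ⟨hL, fun L' hL' => ?_⟩
    by_contra hne
    have h2' := h4 [L', L] (by simp [hne]) (by simp [hL, hL'])
    have hw' := card_le_wsum w (L' ∪ L) (fun v hv => by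
      rcases Finset.mem_union.1 hv with h | h
      · exact h1 L' hL' v h
      · exact h1 L hL v h)
    have hint : (L' ∩ L).card ≤ 1 := h3 L' hL' L hL hne
    have h3L' := (h2 L' hL').1
    have hsd : (L' \ L).card = L'.card - (L' ∩ L).card := by
      rw [Finset.card_sdiff, Finset.inter_comm]
    have hun : (L' ∪ L).card + (L' ∩ L).card = L'.card + L.card := Finset.card_union_add_card_inter L' L
    simp only [unionL, lineRank, Finset.union_empty, Finset.sdiff_empty, Finset.inter_empty, Finset.card_empty,
      Nat.zero_add] at h2'
    omega
  subst hsingle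
  simp [hcard, hfat, capPaper]

/-- **THE SPEC IN THE SEARCHES' OWN WORDS**: the cost clause only for the ORDERINGS OF THE WHOLE CONFIGURATION
(`σ` a duplicate-free list with exactly the lines of `ls`: `wsum (unionL σ) ≤ ν + lineRank σ` for every such `σ`,
i.e. `|V|_w − min_σ lineRank σ ≤ ν`, the search's `cost ≤ ν`); everything else as in `FourCapSpec`. This is what
fourcap.py / fourcap.c verify; `FourCapSpec.of_spec'` passes it to the bridge's form. -/
def FourCapSpec' (cap : ℕ → ℕ → ℕ) (ν Q : ℕ) : Prop :=
  ∀ (β : Type) [DecidableEq β] (w : β → ℕ) (ls : Finset (Finset β)),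
    (∀ L ∈ ls, ∀ v ∈ L, w v = 1 ∨ w v = 2) →
    (∀ L ∈ ls, 3 ≤ L.card ∧ wsum w L ≤ 5) →
    (∀ L ∈ ls, ∀ L' ∈ ls, L ≠ L' → (L ∩ L').card ≤ 1) →
    (∀ σ : List (Finset β), σ.Nodup → (∀ L, L ∈ σ ↔ L ∈ ls) → wsum w (unionL σ) ≤ ν + lineRank σ) →
    (∀ l : List (Finset β), l.Nodup → (∀ L ∈ l, L ∈ ls) → lineRank l ≤ 3 → (unionL l).card ≤ 9) →
    (∀ l : List (Finset β), l.Nodup → (∀ L ∈ l, L ∈ ls) → lineRank l ≤ 4 → (unionL l).card ≤ 20) →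
    ∑ L ∈ ls, cap L.card (fat w L) ≤ Q

/-- The searches' form implies the bridge's form: a configuration whose every sub-list satisfies the cost clause
satisfies it for its full orderings. -/
theorem FourCapSpec.of_spec' {cap : ℕ → ℕ → ℕ} {ν Q : ℕ} (h : FourCapSpec' cap ν Q) : FourCapSpec cap ν Q := by
  intro β _ w ls h1 h2 h3 h4 h5 h6
  exact h β w ls h1 h2 h3 (fun σ hσ hmem => h4 σ hσ (fun L hL => (hmem L).1 hL)) h5 h6

/-- Adding a line at the head raises `lineRank` by at most its number of new points. -/
theorem lineRank_cons_le (L : Finset β) (l : List (Finset β)) :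
    lineRank (L :: l) ≤ lineRank l + (L \ unionL l).card :=
  Nat.add_le_add_left (min_le_left _ _) _

/-- `wsum` is superadditive over a union (weights are natural numbers). -/
theorem wsum_union_ge (w : β → ℕ) (S T : Finset β) : wsum w S + wsum w (T \ S) = wsum w (S ∪ T) := by
  unfold wsum
  rw [← Finset.sum_union Finset.disjoint_sdiff, Finset.union_sdiff_self_eq_union]

/-- **Cost is monotone under adding lines** (the paper's §1 lemma, for the ordering that adds the extra lines
last): `wsum (unionL l) − lineRank l ≤ wsum (unionL (t ++ l)) − lineRank (t ++ l)`, in subtraction-free form. -/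
theorem cost_mono_append (w : β → ℕ) (l : List (Finset β)) :
    ∀ t : List (Finset β), (∀ L ∈ t, ∀ v ∈ L, 1 ≤ w v) →
      wsum w (unionL l) + lineRank (t ++ l) ≤ wsum w (unionL (t ++ l)) + lineRank l
  | [], _ => by simp
  | L :: t, hw => by
    have ih := cost_mono_append w l t (fun L' hL' v hv => hw L' (List.mem_cons_of_mem _ hL') v hv)
    have h1 : lineRank (L :: (t ++ l)) ≤ lineRank (t ++ l) + (L \ unionL (t ++ l)).card := lineRank_cons_le L (t ++ l)
    have h2 : wsum w (unionL (t ++ l)) + wsum w (L \ unionL (t ++ l)) = wsum w (unionL (L :: (t ++ l))) := by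
      simp only [unionL]
      rw [Finset.union_comm]
      exact wsum_union_ge w _ _
    have h3 : (L \ unionL (t ++ l)).card ≤ wsum w (L \ unionL (t ++ l)) := by
      unfold wsum
      rw [Finset.card_eq_sum_ones]
      exact Finset.sum_le_sum (fun v hv => hw L List.mem_cons_self v (Finset.mem_sdiff.1 hv).1)
    simp only [List.cons_append]
    omega

/-- **The two forms of the spec are equivalent**: the bridge's form (cost clause for every sub-list) follows from
the searches' form (`FourCapSpec.of_spec'`), and conversely a configuration whose full orderings obey the cost
clause has every sub-list obeying it (`cost_mono_append`, the complementary lines added last). -/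
theorem fourCapSpec_iff {cap : ℕ → ℕ → ℕ} {ν Q : ℕ} : FourCapSpec cap ν Q ↔ FourCapSpec' cap ν Q := by
  refine ⟨fun h => ?_, FourCapSpec.of_spec'⟩
  intro β _ w ls h1 h2 h3 h4 h5 h6
  refine h β w ls h1 h2 h3 (fun l hl hls => ?_) h5 h6
  set t := (ls \ l.toFinset).toList with ht
  have htmem : ∀ L, L ∈ t ↔ L ∈ ls ∧ L ∉ l := by
    intro L; rw [ht, Finset.mem_toList, Finset.mem_sdiff, List.mem_toFinset]
  have hnd : (t ++ l).Nodup := by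
    rw [List.nodup_append']
    refine ⟨Finset.nodup_toList _, hl, ?_⟩
    intro L hLt hLl
    exact ((htmem L).1 hLt).2 hLl
  have hfull : ∀ L, L ∈ t ++ l ↔ L ∈ ls := by
    intro L
    rw [List.mem_append, htmem]
    constructor
    · rintro (⟨h, _⟩ | h)
      · exact h
      · exact hls L h
    · intro hL
      by_cases hLl : L ∈ l
      · exact Or.inr hLl
      · exact Or.inl ⟨hL, hLl⟩
  have hcost := h4 (t ++ l) hnd hfull
  have hmono := cost_mono_append w l t (fun L hL v hv => by
    rcases h1 L ((htmem L).1 hL).1 v hv with h | h <;> omega)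
  omega

/-- The two-line cost clause at nullity `ν`, unpacked: for distinct lines `L, L'` of a configuration,
`wsum (L' ∪ L) ≤ ν + min |L| 2 + min |L' ∖ L| (2 − min |L' ∩ L| 2)`. -/
theorem two_line_cost {w : β → ℕ} {ls : Finset (Finset β)} {ν : ℕ}
    (h4 : ∀ l : List (Finset β), l.Nodup → (∀ L ∈ l, L ∈ ls) → wsum w (unionL l) ≤ ν + lineRank l)
    {L L' : Finset β} (hL : L ∈ ls) (hL' : L' ∈ ls) (hne : L' ≠ L) :
    wsum w (L' ∪ L) ≤ ν + (min L.card 2 + min (L' \ L).card (2 - min (L' ∩ L).card 2)) := by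
  have h := h4 [L', L] (by simp [hne]) (by simp [hL, hL'])
  simp only [unionL, lineRank, Finset.union_empty, Finset.sdiff_empty, Finset.inter_empty, Finset.card_empty,
    Nat.zero_add] at h
  rw [show (2 - min 0 2 : ℕ) = 2 by decide] at h
  exact h

/-- The three-line cost clause at nullity `ν`, unpacked. -/
theorem three_line_cost {w : β → ℕ} {ls : Finset (Finset β)} {ν : ℕ}
    (h4 : ∀ l : List (Finset β), l.Nodup → (∀ L ∈ l, L ∈ ls) → wsum w (unionL l) ≤ ν + lineRank l)
    {L L' L'' : Finset β} (hL : L ∈ ls) (hL' : L' ∈ ls) (hL'' : L'' ∈ ls) (h1 : L' ≠ L) (h2 : L'' ≠ L)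
    (h3 : L'' ≠ L') :
    wsum w (L'' ∪ (L' ∪ L)) ≤ ν + (min L.card 2 + min (L' \ L).card (2 - min (L' ∩ L).card 2) +
      min (L'' \ (L' ∪ L)).card (2 - min (L'' ∩ (L' ∪ L)).card 2)) := by
  have h := h4 [L'', L', L] (by simp [h1, h2, h3]) (by simp [hL, hL', hL''])
  simp only [unionL, lineRank, Finset.union_empty, Finset.sdiff_empty, Finset.inter_empty, Finset.card_empty,
    Nat.zero_add] at h
  rw [show (2 - min 0 2 : ℕ) = 2 by decide] at h
  exact h

/-- **Sanity instance, proved**: at nullity `2` the spec holds with `Q = 4` — a configuration of cost `≤ 2` is one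
line of weight `≤ 4` (cap `≤ 4`) or two simple 3-lines (cap `1 + 1`); three lines are impossible. -/
theorem fourCapSpec_two : FourCapSpec capPaper 2 4 := by
  intro β _ w ls h1 h2 h3 h4 _ _
  have hwsum : ∀ L ∈ ls, wsum w L ≤ 4 := by
    intro L hL
    have h := h4 [L] (List.nodup_singleton L) (by simpa using hL)
    simp only [unionL, lineRank, Finset.union_empty, Finset.sdiff_empty, Finset.inter_empty, Finset.card_empty,
      Nat.zero_add] at h
    omega
  have hcap : ∀ L ∈ ls, capPaper L.card (fat w L) ≤ 4 := by
    intro L hL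
    have h3L := (h2 L hL).1
    have hw := wsum_eq_card_add_fat w L (h1 L hL)
    have h4L := hwsum L hL
    rcases (by omega : (L.card = 3 ∧ fat w L = 0) ∨ (L.card = 4 ∧ fat w L = 0) ∨ (L.card = 3 ∧ fat w L = 1))
      with ⟨hk, hf⟩ | ⟨hk, hf⟩ | ⟨hk, hf⟩ <;> rw [hk, hf] <;> decide
  -- the line added last in a two-line ordering has weight exactly 3 and the union has weight `6 − |L' ∩ L|`
  have hlast : ∀ L ∈ ls, ∀ L' ∈ ls, L' ≠ L → wsum w L' = 3 ∧ wsum w (L' ∪ L) = 6 - (L' ∩ L).card := by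
    intro L hL L' hL' hne
    have h := two_line_cost h4 hL hL' hne
    have hint : (L' ∩ L).card ≤ 1 := h3 L' hL' L hL hne
    have h3L := (h2 L hL).1
    have h3L' := (h2 L' hL').1
    have hsd : (L' \ L).card + (L' ∩ L).card = L'.card := by
      rw [Finset.card_sdiff, Finset.inter_comm]; exact Nat.sub_add_cancel (Finset.card_le_card Finset.inter_subset_left)
    have hsd' : (L \ L').card + (L' ∩ L).card = L.card := by
      rw [Finset.card_sdiff]; exact Nat.sub_add_cancel (Finset.card_le_card Finset.inter_subset_right)
    have hwu : wsum w (L' ∪ L) = wsum w L' + wsum w (L \ L') := (wsum_union_ge w L' L).symm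
    have hcL' : L'.card ≤ wsum w L' := card_le_wsum w L' (h1 L' hL')
    have hcLL' : (L \ L').card ≤ wsum w (L \ L') :=
      card_le_wsum w (L \ L') (fun v hv => h1 L hL v (Finset.mem_sdiff.1 hv).1)
    omega
  rcases Finset.eq_empty_or_nonempty ls with hempty | ⟨L, hL⟩
  · subst hempty; simp
  by_cases hsingle : ls = {L}
  · subst hsingle; simpa using hcap L (Finset.mem_singleton_self L)
  obtain ⟨L', hL', hne⟩ : ∃ L' ∈ ls, L' ≠ L := by
    by_contra hno; push Not at hno
    exact hsingle (Finset.eq_singleton_iff_unique_mem.2 ⟨hL, hno⟩)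
  have hpair : ls = {L, L'} := by
    by_contra hne2
    have hss : ({L, L'} : Finset (Finset β)) ⊂ ls := by
      refine Finset.ssubset_iff_subset_ne.2 ⟨?_, fun h => hne2 h.symm⟩
      intro x hx; simp only [Finset.mem_insert, Finset.mem_singleton] at hx
      rcases hx with rfl | rfl <;> assumption
    obtain ⟨L'', hL'', hnot⟩ := Finset.exists_of_ssubset hss
    simp only [Finset.mem_insert, Finset.mem_singleton, not_or] at hnot
    have h := three_line_cost h4 hL hL' hL'' hne hnot.1 hnot.2
    obtain ⟨_, hu⟩ := hlast L hL L' hL' hne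
    have hint : (L' ∩ L).card ≤ 1 := h3 L' hL' L hL hne
    have h3L := (h2 L hL).1
    have h3L' := (h2 L' hL').1
    have h3L'' := (h2 L'' hL'').1
    have hj : (L'' ∩ (L' ∪ L)).card ≤ 2 := by
      rw [Finset.inter_union_distrib_left]
      refine (Finset.card_union_le _ _).trans ?_
      have := h3 L'' hL'' L' hL' hnot.2
      have := h3 L'' hL'' L hL hnot.1
      omega
    have hsd : (L'' \ (L' ∪ L)).card + (L'' ∩ (L' ∪ L)).card = L''.card := by
      rw [Finset.card_sdiff, Finset.inter_comm]; exact Nat.sub_add_cancel (Finset.card_le_card Finset.inter_subset_left)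
    have hsd1 : (L' \ L).card + (L' ∩ L).card = L'.card := by
      rw [Finset.card_sdiff, Finset.inter_comm]; exact Nat.sub_add_cancel (Finset.card_le_card Finset.inter_subset_left)
    have hwu : wsum w (L'' ∪ (L' ∪ L)) = wsum w (L' ∪ L) + wsum w (L'' \ (L' ∪ L)) := by
      rw [Finset.union_comm]; exact (wsum_union_ge w _ _).symm
    have hc : (L'' \ (L' ∪ L)).card ≤ wsum w (L'' \ (L' ∪ L)) :=
      card_le_wsum w _ (fun v hv => h1 L'' hL'' v (Finset.mem_sdiff.1 hv).1)
    omega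
  subst hpair
  obtain ⟨hw', _⟩ := hlast L hL L' hL' hne
  obtain ⟨hw, _⟩ := hlast L' hL' L hL hne.symm
  have hwL := wsum_eq_card_add_fat w L (h1 L hL)
  have hwL' := wsum_eq_card_add_fat w L' (h1 L' hL')
  have h3L := (h2 L hL).1
  have h3L' := (h2 L' hL').1
  have hk : L.card = 3 := by omega
  have hk' : L'.card = 3 := by omega
  have hf : fat w L = 0 := by omega
  have hf' : fat w L' = 0 := by omega
  rw [Finset.sum_pair hne.symm, hk, hk', hf, hf']
  decide

end FourCap







end S1

end PercRepro
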